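import Summits.MatrixMultiplication.MatrixMultiplication.Theses.FarEdgeDescent
import Literature.Computability.AlgebraicComplexity.RectangularExponentInformationBound
import HarnessLib

/-!
# Route `FarEdgeDescent` — on the special side of the dichotomy the generic law is FREE IN THE TAIL:
`LogRate → OctaveFlatness → (AnchoredLogConvexity at every large integer m)`, PROVED

The two leaves of the node `ω = 2 ⟺ FiniteSaturation ∧ AnchoredLogConvexity` are not independent debts.
`FiniteSaturation` (stmt-23739) is split as `PowerAmortisation ∧ OctaveFlatness` (glue stmt-25349, landed); this
file shows that its LAW-half `OctaveFlatness` (stmt-25348: `∀ l > 1`, eventually `e(k) ≤ l·e(2k)`), together with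
the landed rung `LogRate` (stmt-25370: `e(k) ≤ log 2 / log(2k+2)`), already proves the generic crux
`AnchoredLogConvexity` (stmt-28900: `e(m)² ≤ e(1)·e(2m−1)`) at every sufficiently large INTEGER `m`
(`alc_eventually_of_logRate_of_octaveFlatness`): either `e(1) = 0` and both sides vanish, or once
`log 2 / log(2m+2) ≤ e(1)/2` (i.e. `m ≥ m₀ ≈ 4^{1/(ω−2)}`), `e(m)² ≤ (e(1)/2)·(2·e(2m)) ≤ e(1)·e(2m−1)`.
So on the FS side the law's content is a BOUNDED WINDOW of shapes — made exact by the dial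
`ω = 2 ⟺ E₂ ∧ (law on (1, 3/2])` in `FarEdgeDescentLadderBridge.mm_iff_twoSaturation_and_alcWindow`.
Also recorded: the unconditional far-tail bound the argument uses, `e(m) ≤ e(1)/2` for `m ≥ m₀`
needs only `LogRate` (`excess_le_half_excess_one_eventually`).

Written by the decomp-mm lens-2 planner seat (gen 8) from the kernel `HOME/decomp-mm-lens-2/FarEdgeDescent_v7.lean` §B;
imports only BUILT modules (the route file + Literature). [cite: LottiRomani1983, §2 (p. 174)] [cite: CoppersmithWinograd1990, §8]
-/

set_option linter.dupNamespace false

noncomputable section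

namespace Summit.MatrixMultiplication.MatrixMultiplication.Theorems.FarEdgeDescentTailLaw

open Literature.Computability.AlgebraicComplexity
open Summit.MatrixMultiplication.MatrixMultiplication.Theses.FarEdgeDescent

/-- From `LogRate` alone: if `e(1) > 0` then `e(m) ≤ e(1)/2` for every integer `m ≥ m₀`
(`m₀ := ⌈exp(2 log 2 / e(1))⌉`, so that `log 2 / log(2m+2) ≤ e(1)/2`). -/
theorem excess_le_half_excess_one_eventually (hL : LogRate) (hpos : 0 < omegaRect ℂ 1 1 1 - 2) :
    ∃ m₀ : ℕ, 1 ≤ m₀ ∧ ∀ m : ℕ, m₀ ≤ m →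
      omegaRect ℂ 1 m 1 - (m + 1) ≤ (omegaRect ℂ 1 1 1 - 2) / 2 := by
  obtain ⟨N, hN⟩ := exists_nat_ge (Real.exp (2 * Real.log 2 / (omegaRect ℂ 1 1 1 - 2)))
  refine ⟨max N 1, le_max_right N 1, fun m hm => ?_⟩
  have hmN : N ≤ m := le_trans (le_max_left N 1) hm
  have hm1 : 1 ≤ m := le_trans (le_max_right N 1) hm
  have hmR : (1 : ℝ) ≤ m := by exact_mod_cast hm1
  have hl2 : 0 < Real.log 2 := Real.log_pos one_lt_two
  have hlog : Real.log 2 / Real.log (2 * m + 2) ≤ (omegaRect ℂ 1 1 1 - 2) / 2 := by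
    have hNm : (N : ℝ) ≤ m := by exact_mod_cast hmN
    have hexp : Real.exp (2 * Real.log 2 / (omegaRect ℂ 1 1 1 - 2)) ≤ 2 * m + 2 := by linarith
    have hden : 2 * Real.log 2 / (omegaRect ℂ 1 1 1 - 2) ≤ Real.log (2 * m + 2) := by
      have := Real.log_le_log (Real.exp_pos _) hexp
      rwa [Real.log_exp] at this
    have hdpos : 0 < 2 * Real.log 2 / (omegaRect ℂ 1 1 1 - 2) := div_pos (by linarith) hpos
    have hne1 : Real.log 2 ≠ 0 := hl2.ne'
    calc Real.log 2 / Real.log (2 * m + 2) ≤ Real.log 2 / (2 * Real.log 2 / (omegaRect ℂ 1 1 1 - 2)) :=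
          div_le_div_of_nonneg_left hl2.le hdpos hden
      _ = (omegaRect ℂ 1 1 1 - 2) / 2 := by
          rw [div_div_eq_mul_div, mul_comm (2 : ℝ) (Real.log 2), mul_div_mul_left _ _ hne1]
  have h := hL m hm1
  linarith

/-- **On the special side the law is free in the tail (PROVED).** `LogRate` and `OctaveFlatness` (used with
`l = 2`) give `AnchoredLogConvexity` at every integer `m ≥ m₀`:
`e(m)² ≤ (e(1)/2)·(2·e(2m)) ≤ e(1)·e(2m−1)` (the excess is non-increasing in the shape), or trivially if
`e(1) = 0`. The threshold `m₀ = max(k₀(2), ⌈4^{1/e(1)}⌉)` is astronomically large when `ω − 2` is small: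
the law's genuine content is the window below it. -/
theorem alc_eventually_of_logRate_of_octaveFlatness (hL : LogRate) (hO : OctaveFlatness) :
    ∃ m₀ : ℕ, 1 ≤ m₀ ∧ ∀ m : ℕ, m₀ ≤ m →
      (omegaRect ℂ 1 m 1 - (m + 1)) ^ 2 ≤
        (omegaRect ℂ 1 1 1 - 2) * (omegaRect ℂ 1 (2 * m - 1) 1 - 2 * m) := by
  have h1 : 0 ≤ omegaRect ℂ 1 1 1 - 2 := by
    have h := add_one_le_omegaRect_one_mid_one ℂ (1 : ℝ)
    linarith
  rcases h1.eq_or_lt with hz | hpos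
  · -- e(1) = 0: then e(m) = 0 for every m ≥ 1 (antitone, nonnegative) and both sides vanish
    refine ⟨1, le_rfl, fun m hm => ?_⟩
    have hm1 : (1 : ℝ) ≤ m := by exact_mod_cast hm
    have ha := omegaRect_one_mid_one_le_add ℂ (p := (m : ℝ)) (q := 1) hm1
    have hn := add_one_le_omegaRect_one_mid_one ℂ (m : ℝ)
    have hem : omegaRect ℂ 1 m 1 - (m + 1) = 0 := by linarith
    rw [hem, ← hz]
    simp
  · obtain ⟨k₀, -, hOF⟩ := hO 2 one_lt_two
    obtain ⟨m₁, hm₁, hhalf⟩ := excess_le_half_excess_one_eventually hL hpos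
    refine ⟨max k₀ m₁, le_trans hm₁ (le_max_right _ _), fun m hm => ?_⟩
    have hmk : k₀ ≤ m := le_trans (le_max_left _ _) hm
    have hmm : m₁ ≤ m := le_trans (le_max_right _ _) hm
    have hA : omegaRect ℂ 1 m 1 - (m + 1) ≤ (omegaRect ℂ 1 1 1 - 2) / 2 := hhalf m hmm
    have hB : omegaRect ℂ 1 m 1 - (m + 1) ≤ 2 * (omegaRect ℂ 1 (2 * m - 1) 1 - 2 * m) := by
      have hof := hOF m hmk
      have hanti := omegaRect_one_mid_one_le_add ℂ (p := 2 * (m : ℝ)) (q := 2 * m - 1) (by linarith)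
      linarith
    have hnn : 0 ≤ omegaRect ℂ 1 m 1 - (m + 1) := by
      have h := add_one_le_omegaRect_one_mid_one ℂ (m : ℝ)
      linarith
    calc (omegaRect ℂ 1 m 1 - (m + 1)) ^ 2
        = (omegaRect ℂ 1 m 1 - (m + 1)) * (omegaRect ℂ 1 m 1 - (m + 1)) := pow_two _
      _ ≤ (omegaRect ℂ 1 1 1 - 2) / 2 * (2 * (omegaRect ℂ 1 (2 * m - 1) 1 - 2 * m)) :=
          mul_le_mul hA hB hnn (by linarith)
      _ = (omegaRect ℂ 1 1 1 - 2) * (omegaRect ℂ 1 (2 * m - 1) 1 - 2 * m) := by ring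

/-- The same, by name on the generic crux's integer instances: under `LogRate ∧ OctaveFlatness` only finitely
many INTEGER instances of `AnchoredLogConvexity` can fail. -/
theorem alc_integer_failures_bounded (hL : LogRate) (hO : OctaveFlatness) :
    ∃ m₀ : ℕ, ∀ m : ℕ, ¬ ((omegaRect ℂ 1 m 1 - (m + 1)) ^ 2 ≤
        (omegaRect ℂ 1 1 1 - 2) * (omegaRect ℂ 1 (2 * m - 1) 1 - 2 * m)) → m < m₀ := by
  obtain ⟨m₀, -, h⟩ := alc_eventually_of_logRate_of_octaveFlatness hL hO
  exact ⟨m₀, fun m hm => Nat.lt_of_not_le fun hle => hm (h m hle)⟩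

end Summit.MatrixMultiplication.MatrixMultiplication.Theorems.FarEdgeDescentTailLaw

end
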